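import Literature.Computability.Cryptography.TreeSigDistinguisher
import HarnessLib

/-!
# The authentication-tree scheme, XI: string bricks for the one-time forger

Topic `Literature/Computability/Cryptography`; small `FP` bricks used by the one-time forger `B` of Goldreich's
reduction (proof of Prop. 6.4.15 / 6.4.17), which must recompute deterministically, from its coins, the lazily
sampled table of node blocks (first occurrences of labels), locate its planted slot, find the first query through it,
and cut the forged signature at the planted level:

* `tabulateFn f` — `⟨1ᵏ, y⟩ ↦ listBool [f ⟨⟨1ᵏ, y⟩, 1⁰⟩, …, f ⟨⟨1ᵏ, y⟩, 1^{k-1}⟩]` for `f` of linear growth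
  (the fold loop `FoldBricks.foldLoop` with concatenation), `tabulateFn_apply`, `tabulateFn_mem_FP`;
* `firstIdxFn` — `⟨key, listBool items⟩ ↦ 1^{first index of key}` (`|items|` if absent; `firstIdx = List.idxOf`), `firstIdxFn_apply`;
* `restFn` — `⟨1ᵏ, W⟩ ↦ sndFᵏ W` (the list after `k` items, `Brick.sndF_iterate_encList`), `restFn_boolPair`;
* `fitLenFn` — `⟨1ᵐ, w⟩ ↦ fitLen w m`.

All proved; no named facts.

## References

* S. Arora, B. Barak, *Computational Complexity*, CUP 2009, §1.3 (bounded loops), §1.4.1.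
* O. Goldreich, *Foundations of Cryptography II*, CUP 2004, proof of Prop. 6.4.15 (the forger `A`).
-/

namespace Literature.Computability.Cryptography

open _root_.Computability Complexity Complexity.Brick Polynomial
open Complexity.Plumb Complexity.OracleCompose Complexity.HashBricks

namespace TreeSig

/-! ### Tabulation -/

section Tabulate

variable (f : List Bool → List Bool)

/-- The singleton-coded piece `listBool [f z]`. [folklore] -/
noncomputable def enc1F : List Bool → List Bool := fanoutFn f fun _ => []

/-- `enc1F_apply` (bookkeeping). [folklore] -/
@[simp] theorem enc1F_apply (z : List Bool) : enc1F f z = encList [f z] := by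
  rw [enc1F, fanoutFn_apply, encList_singleton]

/-- `enc1F_mem_FP` (bookkeeping). [folklore] -/
theorem enc1F_mem_FP (hf : f ∈ FP) : enc1F f ∈ FP := fanoutFn_mem_FP hf (const_mem_FP _)

/-- The initial record `⟨x, ⟨bin k, ⟨1⁰, ε⟩⟩⟩` of the tabulation, `k = |fstF x|`. [folklore] -/
noncomputable def tabInit : List Bool → List Bool :=
  fanoutFn id (fanoutFn (lenBinF ∘ fstF) (fanoutFn (fun _ => []) fun _ => []))

/-- `tabInit_apply` (bookkeeping). [folklore] -/
theorem tabInit_apply (x : List Bool) : tabInit x = boolPair x (boolPair (encodeNat (fstF x).length) (boolPair (ones 0) [])) := by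
  simp [tabInit, lenBinF_apply, ones]

/-- `tabInit_mem_FP` (bookkeeping). [folklore] -/
theorem tabInit_mem_FP : tabInit ∈ FP :=
  fanoutFn_mem_FP (PolyTimeComputable.id _) (fanoutFn_mem_FP (comp_mem_FP lenBinF_mem_FP fstF_mem_FP)
    (fanoutFn_mem_FP (const_mem_FP _) (const_mem_FP _)))

/-- **Tabulation**: `⟨1ᵏ, y⟩ ↦ listBool [f ⟨⟨1ᵏ, y⟩, 1ʲ⟩ : j < k]`, the pieces clipped at `C (|x| + 1)`.
[Arora–Barak 2009, §1.3 (bounded loops)] [cite: AroraBarak2009, §1.3] -/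
noncomputable def tabulateFn (C : ℕ) : List Bool → List Bool := sndPow 2 ∘ foldLoop appF (clipF C (enc1F f)) X ∘ tabInit

/-- The fold of concatenation over singleton codes is the code of the list. [folklore] -/
theorem foldAcc_appF_enc1F (x : List Bool) : ∀ (k i : ℕ) (acc : List Bool),
    foldAcc appF (enc1F f) x i k acc = acc ++ encList ((List.range k).map fun j => f (boolPair x (ones (i + j))))
  | 0, i, acc => by simp
  | k + 1, i, acc => by
    rw [foldAcc_succ, appF_boolPair, enc1F_apply, foldAcc_appF_enc1F x k (i + 1), List.append_assoc, ← encList_append,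
      List.singleton_append, List.range_succ_eq_map, List.map_cons, List.map_map, Nat.add_zero]
    congr 3
    refine List.map_congr_left fun j _ => ?_
    simp only [Function.comp_apply]
    congr 3; omega

/-- **Value of the tabulation** when the pieces are short. [folklore] -/
theorem tabulateFn_apply {C : ℕ} (u y : List Bool) (h : ∀ j < u.length, (f (boolPair (boolPair u y) (ones j))).length * 2 + 2 ≤ C * ((boolPair u y).length + 1)) :
    tabulateFn f C (boolPair u y) = encList ((List.range u.length).map fun j => f (boolPair (boolPair u y) (ones j))) := by
  rw [tabulateFn, Function.comp_apply, Function.comp_apply, tabInit_apply, fstF_boolPair,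
    foldLoop_apply _ _ (by rw [eval_X, length_boolPair]; omega) 0 [], foldAcc_clipF (fun j _ hj => ?_), foldAcc_appF_enc1F,
    List.nil_append]
  · simp only [sndPow_succ_boolPair, sndPow_zero_boolPair, Nat.zero_add]
  · rw [enc1F_apply, encList_singleton, length_boolPair, List.length_nil]
    have := h j (by omega)
    omega

/-- **`tabulateFn f C ∈ FP`** for `f ∈ FP`. [cite: AroraBarak2009, §1.3] -/
theorem tabulateFn_mem_FP (hf : f ∈ FP) (C : ℕ) : tabulateFn f C ∈ FP :=
  comp_mem_FP (sndPow_mem_FP 2) (comp_mem_FP (foldLoop_clipF_mem_FP C appF_mem_FP length_appF_le (enc1F_mem_FP f hf) X) tabInit_mem_FP)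

end Tabulate

/-! ### First index of an item -/

/-- The first index of `key` in `items` (`|items|` if absent): Mathlib's `List.idxOf`. [folklore] -/
abbrev firstIdx (key : List Bool) (items : List (List Bool)) : ℕ := items.idxOf key

/-- `firstIdx_le_length` (bookkeeping; `List.idxOf_le_length`). [folklore] -/
theorem firstIdx_le_length (key : List Bool) (items : List (List Bool)) : firstIdx key items ≤ items.length := List.idxOf_le_length

/-- `getElem_firstIdx` (bookkeeping; `List.getElem_idxOf`). [folklore] -/
theorem getElem_firstIdx (key : List Bool) (items : List (List Bool)) (h : firstIdx key items < items.length) : items[firstIdx key items] = key :=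
  List.getElem_idxOf h

/-- `firstIdx_le_of_getElem` (bookkeeping): the first occurrence is at most any occurrence. [folklore] -/
theorem firstIdx_le_of_getElem (key : List Bool) : ∀ (items : List (List Bool)) (j : ℕ) (hj : j < items.length), items[j] = key → firstIdx key items ≤ j
  | [], j, hj, _ => by simp at hj
  | a :: items, 0, _, h => by simp only [List.getElem_cons_zero] at h; simp [firstIdx, List.idxOf_cons_eq _ h]
  | a :: items, j + 1, hj, h => by
    by_cases ha : a = key
    · simp [firstIdx, List.idxOf_cons_eq _ ha]
    · rw [firstIdx, List.idxOf_cons_ne _ ha]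
      exact Nat.succ_le_succ (firstIdx_le_of_getElem key items j (by simpa using hj) (by simpa using h))

/-- `firstIdx_lt_length_of_mem` (bookkeeping; `List.idxOf_lt_length_of_mem`). [folklore] -/
theorem firstIdx_lt_length_of_mem {key : List Bool} {items : List (List Bool)} (h : key ∈ items) : firstIdx key items < items.length :=
  List.idxOf_lt_length_of_mem h

/-- The scan step on fold records `⟨w, ⟨item, acc⟩⟩`, `acc = ⟨flag, 1^count⟩`: a found flag is kept; otherwise
`item = fstF w` sets the flag, else the count grows. [folklore] -/
noncomputable def fiStep : List Bool → List Bool :=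
  iteFn (isNilFn ∘ fstF ∘ sndPow 1)
    (iteFn (eqPairFn ∘ fanoutFn (nthF 1) (fstF ∘ fstF))
      (fanoutFn (fun _ => [true]) (sndF ∘ sndPow 1))
      (fanoutFn (fun _ => []) (List.cons true ∘ sndF ∘ sndPow 1)))
    (sndPow 1)

/-- The model of the scan step. [folklore] -/
def fiModel (key : List Bool) (acc item : List Bool) : List Bool :=
  if fstF acc = [] then (if item = key then boolPair [true] (sndF acc) else boolPair [] (true :: sndF acc)) else acc

/-- `fiStep_apply` (bookkeeping). [folklore] -/
theorem fiStep_apply (w item acc : List Bool) : fiStep (boolPair w (boolPair item acc)) = fiModel (fstF w) acc item := by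
  unfold fiStep fiModel
  by_cases hacc : fstF acc = []
  · rw [iteFn_apply_true (by simp [Function.comp_apply, isNilFn, sndPow, hacc]), if_pos hacc]
    by_cases hit : item = fstF w
    · rw [iteFn_apply_true (by simp [Function.comp_apply, eqPairFn_boolPair, nthF, hit]), if_pos hit]
      simp [sndPow]
    · rw [iteFn_apply_false (by simp [Function.comp_apply, eqPairFn_boolPair, nthF, hit]), if_neg hit]
      simp [sndPow]
  · rw [iteFn_apply_false (by simp [Function.comp_apply, isNilFn, sndPow, hacc]), if_neg hacc]
    simp [sndPow]

/-- `fiStep_mem_FP` (bookkeeping). [folklore] -/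
theorem fiStep_mem_FP : fiStep ∈ FP :=
  iteFn_mem_FP (comp_mem_FP isNilFn_mem_FP (comp_mem_FP fstF_mem_FP (sndPow_mem_FP 1)))
    (iteFn_mem_FP (comp_mem_FP eqPairFn_mem_FP (fanoutFn_mem_FP (nthF_mem_FP 1) (comp_mem_FP fstF_mem_FP fstF_mem_FP)))
      (fanoutFn_mem_FP (const_mem_FP _) (comp_mem_FP sndF_mem_FP (sndPow_mem_FP 1)))
      (fanoutFn_mem_FP (const_mem_FP _) (comp_mem_FP (cons_mem_FP true) (comp_mem_FP sndF_mem_FP (sndPow_mem_FP 1)))))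
    (sndPow_mem_FP 1)

/-- `foldGrowth_fiStep` (bookkeeping). [folklore] -/
theorem foldGrowth_fiStep : FoldGrowth 6 fiStep := by
  intro z
  unfold fiStep
  have hz : sndPow 1 z = sndF (sndF z) := rfl
  have h1 := length_fstF_sndF_le (sndF (sndF z))
  rw [iteFn_of_oneBit (oneBit_isNilFn.comp _)]
  split_ifs
  · rw [iteFn_of_oneBit (oneBit_eqPairFn.comp _)]
    split_ifs
    · rw [length_fanoutFn]
      simp only [Function.comp_apply, List.length_singleton, hz]
      omega
    · rw [length_fanoutFn]
      simp only [Function.comp_apply, List.length_nil, List.length_cons, hz]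
      omega
  · rw [hz]; omega

/-- The fold of the scan model from `⟨ε, 1ᶜ⟩`. [folklore] -/
theorem foldl_fiModel (key : List Bool) : ∀ (items : List (List Bool)) (c : ℕ),
    items.foldl (fiModel key) (boolPair [] (ones c)) = boolPair (if key ∈ items then [true] else []) (ones (c + firstIdx key items))
  | [], c => by simp [firstIdx]
  | a :: items, c => by
    rw [List.foldl_cons, fiModel, fstF_boolPair, if_pos rfl, sndF_boolPair]
    by_cases ha : a = key
    · subst ha
      rw [if_pos rfl, firstIdx, List.idxOf_cons_eq _ rfl, if_pos List.mem_cons_self, Nat.add_zero]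
      -- a set flag is kept by the rest of the fold
      have key' : ∀ (l : List (List Bool)) (acc : List Bool), fstF acc ≠ [] → l.foldl (fiModel a) acc = acc := by
        intro l; induction l with
        | nil => intros; rfl
        | cons b l ih => intro acc h; rw [List.foldl_cons, fiModel, if_neg h, ih acc h]
      exact key' items _ (by rw [fstF_boolPair]; simp)
    · rw [if_neg ha, firstIdx, List.idxOf_cons_ne _ ha, show true :: ones c = ones (c + 1) by simp [ones, List.replicate_succ], foldl_fiModel key items (c + 1)]
      congr 1
      · simp [List.mem_cons, Ne.symm ha]
      · rw [firstIdx]; congr 1; omega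

/-- **The first-index brick** `⟨key, listBool items⟩ ↦ 1^{firstIdx key items}`. [Arora–Barak 2009, §1.3] [cite: AroraBarak2009, §1.3] -/
noncomputable def firstIdxFn : List Bool → List Bool := sndF ∘ foldFn fiStep (fun _ => boolPair [] [])

/-- `firstIdxFn_apply` (bookkeeping). [folklore] -/
theorem firstIdxFn_apply (key : List Bool) (items : List (List Bool)) :
    firstIdxFn (boolPair key (encList items)) = ones (firstIdx key items) := by
  rw [firstIdxFn, Function.comp_apply, foldFn_boolPair, decNil_encList]
  have : (fun acc a => fiStep (boolPair (boolPair key (encList items)) (boolPair a acc))) = fiModel key := by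
    funext acc a; rw [fiStep_apply, fstF_boolPair]
  rw [this, show boolPair ([] : List Bool) [] = boolPair [] (ones 0) by rfl, foldl_fiModel, sndF_boolPair, Nat.zero_add]

/-- `firstIdxFn_mem_FP` (bookkeeping). [folklore] -/
theorem firstIdxFn_mem_FP : firstIdxFn ∈ FP :=
  comp_mem_FP sndF_mem_FP (foldFn_mem_FP fiStep_mem_FP (const_mem_FP _) foldGrowth_fiStep)

/-! ### The rest of a list after `k` items; fitting a string to a length -/

/-- `restFn ⟨u, W⟩ = sndF^{|u|} W`. [folklore] -/
noncomputable def restFn : List Bool → List Bool := sndF ∘ fun z => dropItemStep^[X.eval (boolUnpair z).1.length] z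

/-- `restFn_boolPair` (bookkeeping). [folklore] -/
theorem restFn_boolPair (u W : List Bool) : restFn (boolPair u W) = sndF^[u.length] W := by
  simp only [restFn, Function.comp_apply, boolUnpair_boolPair, eval_X, iterate_dropItemStep]
  exact sndF_boolPair _ _

/-- `restFn_mem_FP` (bookkeeping). [folklore] -/
theorem restFn_mem_FP : restFn ∈ FP :=
  comp_mem_FP sndF_mem_FP (iterate_mem_FP dropItemStep_mem_FP 2 length_dropItemStep_le X)

/-- `fitLenFn ⟨1ᵐ, w⟩ = fitLen w m`. [folklore] -/
noncomputable def fitLenFn : List Bool → List Bool :=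
  appF ∘ fanoutFn takeFn (Kannan.zerosFn ∘ dropFn ∘ fanoutFn sndF fstF)

/-- `fitLenFn_boolPair` (bookkeeping). [folklore] -/
theorem fitLenFn_boolPair (u w : List Bool) : fitLenFn (boolPair u w) = fitLen w u.length := by
  simp [fitLenFn, fitLen_eq, Kannan.zerosFn_apply]

/-- `fitLenFn_mem_FP` (bookkeeping). [folklore] -/
theorem fitLenFn_mem_FP : fitLenFn ∈ FP :=
  comp_mem_FP appF_mem_FP (fanoutFn_mem_FP takeFn_mem_FP (comp_mem_FP Kannan.zerosFn_mem_FP (comp_mem_FP dropFn_mem_FP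
    (fanoutFn_mem_FP sndF_mem_FP fstF_mem_FP))))

end TreeSig

end Literature.Computability.Cryptography
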